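import Mathlib.Analysis.Distribution.SchwartzSpace.Basic
import Mathlib.Analysis.Normed.Affine.Isometry
import Mathlib.Topology.Algebra.Module.Equiv
import Mathlib.Analysis.InnerProductSpace.PiL2
import Literature.MathematicalPhysics.QuantumLattice.RandomField
import HarnessLib

-- provenance: harness21/H21/H21/Prelude/QLatticeAQFT/EuclideanAction.lean @ 315230b (interim HEAD d8f2665); M5 mechanical rewrite
/-!
# The Euclidean group action on test functions and field configurations

Trunk **T-AQFT** (G13, Part A, item A2), families `constructive-qft`, `crit-ising`.
Notion: `euclidean_group_action`.

The Euclidean group `E(d) = ℝ^d ⋊ O(d)` (here: the affine isometric automorphisms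
`E ≃ᵃⁱ[ℝ] E` of a real normed space `E`, typically `E = EuclideanSpace ℝ (Fin d)`) acts on test
functions by `(g · f)(x) = f (g⁻¹ x)` and, by transposition, on real tempered distributions
(field configurations `Literature.AQFT.FieldConfig E`) by `(g · ω)(f) = ω (g⁻¹ · f)`, so that the Dirac
configuration `δₓ` is sent to `δ_{g x}`. This file provides

* on test functions `𝓢(E, 𝕜)` (`𝕜 = ℝ` or `ℂ`, `RCLike`): translations `translateTest a`
  (`f ↦ f (· - a)`), linear isometries `linActTest L` (`f ↦ f ∘ L⁻¹`), Euclidean motions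
  `euclidActTest g` (`f ↦ f ∘ g⁻¹`), dilations `dilateTest s hs` (`f ↦ f (s⁻¹ • ·)`); at fixed
  dimension `EuclideanSpace ℝ (Fin d)` (time = coordinate `0`): the time reflection
  `timeReflection d` (`θ : (x⁰, x⃗) ↦ (-x⁰, x⃗)`), `thetaTest`, `timeShiftTest t`;
* their diagonal versions on multi-point test functions `𝓢((Fin n → E), ℂ)`: `translateMulti`,
  `linActMulti`, `thetaMulti`, and the permutation of arguments `permTest σ`;
* on configurations: the transpose `FieldConfig.act T` of a continuous linear map `T` on test
  functions, `translateField`, `rotateField`, `thetaField`, `timeShiftField`, `euclidActField`;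
* invariance predicates on laws (measures on `FieldConfig E`), with the suffix `Law` fixed by the
  outline (§0) to avoid clashes with `Literature.Probability.LatticeModels.IsEuclideanInvariant` etc.:
  `IsEuclideanInvariantLaw`, `IsTranslationInvariantLaw`, `IsRotationInvariantLaw`,
  `IsTimeReflectionInvariantLaw`;
* positive-time test functions (Osterwalder–Schrader's `𝒮₊`, `𝒮_<`): `IsPositiveTime`,
  `IsNonnegTime`, `IsPositiveTimeMulti`, `IsTimeOrdered`, `positiveTimeSubmodule`.

## Sources

* K. Osterwalder, R. Schrader, *Axioms for Euclidean Green's functions*, Comm. Math. Phys. 31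
  (1973) 83–112, §2 (Euclidean group action `f_{(a,R)}(x) = f(R⁻¹(x - a))`, time reflection `θ`,
  the spaces `𝒮₊`, `𝒮_<`, permuted arguments `f^π`).
* J. Glimm, A. Jaffe, *Quantum Physics: a functional integral point of view* (2nd ed. 1987),
  §6.1 (Euclidean invariance OS2 and reflection positivity OS3 for measures on `𝒮'(ℝ^d)`).

## Mathlib

Everything on the test-function side is an instance of existing Mathlib operators:
`SchwartzMap.compSubConstCLM` (translation `f ↦ f (· - a)`),
`SchwartzMap.compCLMOfContinuousLinearEquiv` (composition with a continuous linear equivalence),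
`LinearIsometryEquiv.toContinuousLinearEquiv`, `AffineIsometryEquiv.linearIsometryEquiv`,
`LinearIsometryEquiv.piLpCongrRight` and `LinearIsometryEquiv.neg` (to build `timeReflection`),
`ContinuousLinearEquiv.smulLeft` (dilations), `ContinuousLinearEquiv.piCongrRight` /
`ContinuousLinearEquiv.piCongrLeft` (diagonal actions and permutations on `Fin n → E`),
`PointwiseConvergenceCLM.precomp` (transpose on the weak-* dual), `tsupport`.
Mathlib has no bundled Euclidean-group action on `𝓢` nor the OS positive-time spaces (searched:
`timeReflection`, `positiveTime`, `Osterwalder`); the thin named wrappers below fix conventions.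

## Design

* No `abbrev` for `EuclideanSpace ℝ (Fin d)` (outline §0). Generic statements are over a real
  normed space `E`; fixed-dimension ones use `EuclideanSpace ℝ (Fin d)` with `[NeZero d]` so that
  the time coordinate `0 : Fin d` exists. The time unit vector is `EuclideanSpace.single 0 1`, and
  `timeShiftTest t` translates by `EuclideanSpace.single 0 t = t • EuclideanSpace.single 0 1`.
* Conventions: `linActTest L f = f ∘ L⁻¹`, `euclidActTest g f = f ∘ g⁻¹` (a *left* action on test
  functions); on configurations `euclidActField g = (euclidActTest g⁻¹)ᵗ`, i.e.
  `(euclidActField g ω) f = ω (f ∘ g)`, again a left action, with `δₓ ↦ δ_{g x}`.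
  `permTest σ F x = F (x ∘ σ)` (OS 1973 §2, `f^π`).
* Test-function scalars are generic `𝕜` (`RCLike`); configurations are real (`FieldConfig E` is the
  dual of `𝓢(E, ℝ)`), multi-point test functions are complex (outline §0).
-/

open scoped SchwartzMap
open MeasureTheory

namespace Literature.MathematicalPhysics.QuantumLattice

/-! ### Action on one-point test functions -/

section Test

variable {𝕜 : Type*} [RCLike 𝕜]
variable {E : Type*} [NormedAddCommGroup E] [NormedSpace ℝ E]

/-- Translation of test functions by `a`: `(translateTest a f)(x) = f (x - a)` (OS 1973 §2,
`f_{(a,1)}`). This is Mathlib's `SchwartzMap.compSubConstCLM`. [cite: OS1973, §2] -/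
noncomputable def translateTest (a : E) : 𝓢(E, 𝕜) →L[𝕜] 𝓢(E, 𝕜) :=
  SchwartzMap.compSubConstCLM 𝕜 a

/-- `(translateTest a f)(x) = f (x - a)`. [folklore] -/
@[simp]
theorem translateTest_apply (a : E) (f : 𝓢(E, 𝕜)) (x : E) :
    translateTest a f x = f (x - a) := rfl

/-- Translations compose additively: `T_{a+b} = T_a ∘ T_b` (OS 1973 §2). [cite: OS1973, §2] -/
theorem translateTest_add (a b : E) :
    (translateTest (a + b) : 𝓢(E, 𝕜) →L[𝕜] 𝓢(E, 𝕜)) =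
      (translateTest a).comp (translateTest b) := by
  ext f x
  simp only [translateTest_apply, ContinuousLinearMap.coe_comp, Function.comp_apply]
  congr 1
  abel

/-- Action of a linear isometry `L` (rotation/reflection) on test functions:
`(linActTest L f)(x) = f (L⁻¹ x)` (OS 1973 §2, `f_{(0,R)}(x) = f(R⁻¹ x)`). Built from Mathlib's
`SchwartzMap.compCLMOfContinuousLinearEquiv`. [cite: OS1973, §2] -/
noncomputable def linActTest (L : E ≃ₗᵢ[ℝ] E) : 𝓢(E, 𝕜) →L[𝕜] 𝓢(E, 𝕜) :=
  SchwartzMap.compCLMOfContinuousLinearEquiv 𝕜 L.symm.toContinuousLinearEquiv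

/-- `(linActTest L f)(x) = f (L⁻¹ x)`. [folklore] -/
@[simp]
theorem linActTest_apply (L : E ≃ₗᵢ[ℝ] E) (f : 𝓢(E, 𝕜)) (x : E) :
    linActTest L f x = f (L.symm x) := rfl

/-- Action of a Euclidean motion `g = (a, R)` (an affine isometric automorphism of `E`,
`g x = R x + a` with `a = g 0`, `R = g.linearIsometryEquiv`) on test functions:
`euclidActTest g = translateTest (g 0) ∘ linActTest R`, so that
`(euclidActTest g f)(x) = f (R⁻¹ (x - a)) = f (g⁻¹ x)` (OS 1973 §2, eq. (2.2)). [cite: OS1973, §2 eq. (2.2)] -/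
noncomputable def euclidActTest (g : E ≃ᵃⁱ[ℝ] E) : 𝓢(E, 𝕜) →L[𝕜] 𝓢(E, 𝕜) :=
  (translateTest (g 0)).comp (linActTest g.linearIsometryEquiv)

/-- `(euclidActTest g f)(x) = f (g⁻¹ x)` (OS 1973 §2, eq. (2.2)). [cite: OS1973, §2 eq. (2.2)] -/
@[simp]
theorem euclidActTest_apply (g : E ≃ᵃⁱ[ℝ] E) (f : 𝓢(E, 𝕜)) (x : E) :
    euclidActTest g f x = f (g.symm x) := by
  simp only [euclidActTest, ContinuousLinearMap.coe_comp, Function.comp_apply,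
    translateTest_apply, linActTest_apply]
  congr 1
  apply g.linearIsometryEquiv.injective
  rw [LinearIsometryEquiv.apply_symm_apply]
  have h := g.map_vsub (g.symm x) 0
  rw [AffineIsometryEquiv.apply_symm_apply] at h
  simpa [vsub_eq_sub] using h.symm

/-- Dilation of test functions by a nonzero real scale `s`:
`(dilateTest s hs f)(x) = f (s⁻¹ • x)` (used for scale covariance of scaling limits; Glimm–Jaffe
§6.1). Built from `ContinuousLinearEquiv.smulLeft` of the unit `s⁻¹`. [folklore] -/
noncomputable def dilateTest (s : ℝ) (hs : s ≠ 0) : 𝓢(E, 𝕜) →L[𝕜] 𝓢(E, 𝕜) :=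
  SchwartzMap.compCLMOfContinuousLinearEquiv 𝕜
    (ContinuousLinearEquiv.smulLeft (Units.mk0 s hs)⁻¹ : E ≃L[ℝ] E)

/-- `(dilateTest s hs f)(x) = f (s⁻¹ • x)`. [folklore] -/
@[simp]
theorem dilateTest_apply (s : ℝ) (hs : s ≠ 0) (f : 𝓢(E, 𝕜)) (x : E) :
    dilateTest s hs f x = f (s⁻¹ • x) := rfl

end Test

/-! ### Time reflection and time translations at fixed dimension -/

section Time

variable {𝕜 : Type*} [RCLike 𝕜]
variable (d : ℕ) [NeZero d]

/-- Time reflection `θ : (x⁰, x⃗) ↦ (-x⁰, x⃗)` on `ℝ^d = EuclideanSpace ℝ (Fin d)` (time is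
coordinate `0`), as a linear isometric equivalence: the coordinatewise map which is `-id` on
coordinate `0` and `id` elsewhere (OS 1973 §2, `ϑ`). [cite: OS1973, §2] -/
noncomputable def timeReflection : EuclideanSpace ℝ (Fin d) ≃ₗᵢ[ℝ] EuclideanSpace ℝ (Fin d) :=
  LinearIsometryEquiv.piLpCongrRight 2 fun i : Fin d =>
    if i = 0 then LinearIsometryEquiv.neg ℝ else LinearIsometryEquiv.refl ℝ ℝ

/-- `(θ x) i = -x 0` for `i = 0` and `x i` otherwise. [folklore] -/
@[simp]
theorem timeReflection_apply (x : EuclideanSpace ℝ (Fin d)) (i : Fin d) :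
    timeReflection d x i = if i = 0 then -x i else x i := by
  simp only [timeReflection, LinearIsometryEquiv.piLpCongrRight_apply, PiLp.toLp_apply]
  split_ifs <;> rfl

/-- `θ` is an involution: `θ (θ x) = x`. [folklore] -/
theorem timeReflection_timeReflection (x : EuclideanSpace ℝ (Fin d)) :
    timeReflection d (timeReflection d x) = x := by
  ext i
  simp only [timeReflection_apply]
  split_ifs <;> simp

/-- `θ⁻¹ = θ`. [folklore] -/
@[simp]
theorem timeReflection_symm : (timeReflection d).symm = timeReflection d := by
  ext x : 1
  apply (timeReflection d).injective
  rw [LinearIsometryEquiv.apply_symm_apply, timeReflection_timeReflection]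

/-- Time reflection of test functions, `(Θ f)(x) = f (θ x)` (OS 1973 §2, `(ϑf)(x) = f(ϑx)`). [cite: OS1973, §2] -/
noncomputable def thetaTest :
    𝓢(EuclideanSpace ℝ (Fin d), 𝕜) →L[𝕜] 𝓢(EuclideanSpace ℝ (Fin d), 𝕜) :=
  linActTest (timeReflection d)

/-- `(Θ f)(x) = f (θ x)`. [folklore] -/
@[simp]
theorem thetaTest_apply (f : 𝓢(EuclideanSpace ℝ (Fin d), 𝕜)) (x : EuclideanSpace ℝ (Fin d)) :
    thetaTest d f x = f (timeReflection d x) := by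
  simp [thetaTest]

/-- `Θ` is an involution on test functions (OS 1973 §2). [cite: OS1973, §2] -/
theorem thetaTest_involutive :
    Function.Involutive (thetaTest (𝕜 := 𝕜) d) := by
  intro f
  ext x
  simp [timeReflection_timeReflection]

/-- Time translation of test functions by `t`: translation by `t e₀ = EuclideanSpace.single 0 t`,
`(timeShiftTest t f)(x⁰, x⃗) = f (x⁰ - t, x⃗)` (OS 1973 §2; Glimm–Jaffe §6.1). [cite: OS1973, §2] -/
noncomputable def timeShiftTest (t : ℝ) :
    𝓢(EuclideanSpace ℝ (Fin d), 𝕜) →L[𝕜] 𝓢(EuclideanSpace ℝ (Fin d), 𝕜) :=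
  translateTest (EuclideanSpace.single 0 t)

/-- `(timeShiftTest t f)(x) = f (x - t e₀)`. [folklore] -/
@[simp]
theorem timeShiftTest_apply (t : ℝ) (f : 𝓢(EuclideanSpace ℝ (Fin d), 𝕜))
    (x : EuclideanSpace ℝ (Fin d)) :
    timeShiftTest d t f x = f (x - EuclideanSpace.single 0 t) := rfl

end Time

/-! ### Diagonal action on multi-point test functions -/

section Multi

variable {E : Type*} [NormedAddCommGroup E] [NormedSpace ℝ E]
variable {n : ℕ}

/-- Diagonal translation of an `n`-point test function:
`(translateMulti a F)(x₁, …, xₙ) = F (x₁ - a, …, xₙ - a)` (OS 1973 §2, `f_{(a,1)}` on `𝒮(ℝ^{dn})`).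
This is `SchwartzMap.compSubConstCLM` at the constant vector. [cite: OS1973, §2] -/
noncomputable def translateMulti (a : E) : 𝓢((Fin n → E), ℂ) →L[ℂ] 𝓢((Fin n → E), ℂ) :=
  SchwartzMap.compSubConstCLM ℂ (fun _ : Fin n => a)

/-- `(translateMulti a F) x = F (fun i => x i - a)`. [folklore] -/
@[simp]
theorem translateMulti_apply (a : E) (F : 𝓢((Fin n → E), ℂ)) (x : Fin n → E) :
    translateMulti a F x = F (fun i => x i - a) := rfl

/-- Diagonal action of a linear isometry on an `n`-point test function:
`(linActMulti L F)(x₁, …, xₙ) = F (L⁻¹ x₁, …, L⁻¹ xₙ)` (OS 1973 §2, `f_{(0,R)}`). Built from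
`ContinuousLinearEquiv.piCongrRight`. [cite: OS1973, §2] -/
noncomputable def linActMulti (L : E ≃ₗᵢ[ℝ] E) : 𝓢((Fin n → E), ℂ) →L[ℂ] 𝓢((Fin n → E), ℂ) :=
  SchwartzMap.compCLMOfContinuousLinearEquiv ℂ
    (ContinuousLinearEquiv.piCongrRight fun _ : Fin n => L.symm.toContinuousLinearEquiv)

/-- `(linActMulti L F) x = F (fun i => L⁻¹ (x i))`. [folklore] -/
@[simp]
theorem linActMulti_apply (L : E ≃ₗᵢ[ℝ] E) (F : 𝓢((Fin n → E), ℂ)) (x : Fin n → E) :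
    linActMulti L F x = F (fun i => L.symm (x i)) := rfl

/-- Diagonal time reflection of an `n`-point test function on `(ℝ^d)^n`:
`(Θ F)(x₁, …, xₙ) = F (θ x₁, …, θ xₙ)` (OS 1973 §2, eq. (2.4)). [cite: OS1973, §2 eq. (2.4)] -/
noncomputable def thetaMulti (d : ℕ) [NeZero d] :
    𝓢((Fin n → EuclideanSpace ℝ (Fin d)), ℂ) →L[ℂ] 𝓢((Fin n → EuclideanSpace ℝ (Fin d)), ℂ) :=
  linActMulti (timeReflection d)

/-- `(thetaMulti d F) x = F (fun i => θ (x i))`. [folklore] -/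
@[simp]
theorem thetaMulti_apply (d : ℕ) [NeZero d] (F : 𝓢((Fin n → EuclideanSpace ℝ (Fin d)), ℂ))
    (x : Fin n → EuclideanSpace ℝ (Fin d)) :
    thetaMulti d F x = F (fun i => timeReflection d (x i)) := by
  simp [thetaMulti]

/-- Permutation of the arguments of an `n`-point test function:
`(permTest σ F)(x₁, …, xₙ) = F (x_{σ 1}, …, x_{σ n})`, i.e. `permTest σ F = F ∘ (· ∘ σ)`
(OS 1973 §2, `f^π`). Built from `ContinuousLinearEquiv.piCongrLeft`. [cite: OS1973, §2] -/
noncomputable def permTest (σ : Equiv.Perm (Fin n)) : 𝓢((Fin n → E), ℂ) →L[ℂ] 𝓢((Fin n → E), ℂ) :=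
  SchwartzMap.compCLMOfContinuousLinearEquiv ℂ
    (ContinuousLinearEquiv.piCongrLeft ℝ (fun _ : Fin n => E) σ.symm)

/-- `(permTest σ F) x = F (x ∘ σ)`. [folklore] -/
@[simp]
theorem permTest_apply (σ : Equiv.Perm (Fin n)) (F : 𝓢((Fin n → E), ℂ)) (x : Fin n → E) :
    permTest σ F x = F (x ∘ σ) := by
  simp only [permTest, SchwartzMap.compCLMOfContinuousLinearEquiv_apply, Function.comp_apply]
  congr 1
  funext i
  simp [ContinuousLinearEquiv.piCongrLeft, Equiv.piCongrLeft_apply_eq_cast]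

end Multi

/-! ### Action on field configurations -/

section Config

variable {E : Type*} [NormedAddCommGroup E] [NormedSpace ℝ E]

/-- The transpose of a continuous linear map `T` on real test functions, acting on field
configurations: `(FieldConfig.act T ω) f = ω (T f)`. Continuous for the weak-* topology
(Mathlib `PointwiseConvergenceCLM.precomp`). Glimm–Jaffe §6.1. [folklore] -/
noncomputable def FieldConfig.act (T : 𝓢(E, ℝ) →L[ℝ] 𝓢(E, ℝ)) : FieldConfig E →L[ℝ] FieldConfig E :=
  PointwiseConvergenceCLM.precomp ℝ T

/-- `(FieldConfig.act T ω) f = ω (T f)`. [folklore] -/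
@[simp]
theorem FieldConfig.act_apply (T : 𝓢(E, ℝ) →L[ℝ] 𝓢(E, ℝ)) (ω : FieldConfig E) (f : 𝓢(E, ℝ)) :
    FieldConfig.act T ω f = ω (T f) := rfl

/-- Transposition reverses composition: `(T ∘ S)ᵗ = Sᵗ ∘ Tᵗ`. [folklore] -/
theorem FieldConfig.act_comp (T S : 𝓢(E, ℝ) →L[ℝ] 𝓢(E, ℝ)) :
    FieldConfig.act (T.comp S) = (FieldConfig.act S).comp (FieldConfig.act T) := rfl

/-- The transpose action is (Borel) measurable, being weak-* continuous. Glimm–Jaffe §6.1. [folklore] -/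
theorem FieldConfig.measurable_act (T : 𝓢(E, ℝ) →L[ℝ] 𝓢(E, ℝ)) :
    Measurable (FieldConfig.act T) :=
  (FieldConfig.act T).continuous.measurable

/-- Translation of field configurations by `a`: `(translateField a ω) f = ω (f (· + a))`, so that
`δₓ ↦ δ_{x + a}` (Glimm–Jaffe §6.1; the transpose of `translateTest (-a)`). [folklore] -/
noncomputable def translateField (a : E) : FieldConfig E →L[ℝ] FieldConfig E :=
  FieldConfig.act (translateTest (-a))

/-- `(translateField a ω) f = ω (translateTest (-a) f)`. [folklore] -/
@[simp]
theorem translateField_apply (a : E) (ω : FieldConfig E) (f : 𝓢(E, ℝ)) :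
    translateField a ω f = ω (translateTest (-a) f) := rfl

/-- Translation sends the Dirac configuration `δₓ` to `δ_{x + a}`. [folklore] -/
theorem translateField_deltaConfig (a x : E) :
    translateField a (deltaConfig x) = deltaConfig (x + a) := by
  ext f
  simp

/-- Action of a linear isometry `L` on field configurations: `(rotateField L ω) f = ω (f ∘ L)`,
so that `δₓ ↦ δ_{L x}` (Glimm–Jaffe §6.1; the transpose of `linActTest L⁻¹`). [folklore] -/
noncomputable def rotateField (L : E ≃ₗᵢ[ℝ] E) : FieldConfig E →L[ℝ] FieldConfig E :=
  FieldConfig.act (linActTest L.symm)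

/-- `(rotateField L ω) f = ω (linActTest L⁻¹ f)`. [folklore] -/
@[simp]
theorem rotateField_apply (L : E ≃ₗᵢ[ℝ] E) (ω : FieldConfig E) (f : 𝓢(E, ℝ)) :
    rotateField L ω f = ω (linActTest L.symm f) := rfl

/-- Action of a Euclidean motion `g` on field configurations:
`(euclidActField g ω) f = ω (f ∘ g)`, so that `δₓ ↦ δ_{g x}` (Glimm–Jaffe §6.1, OS2; the
transpose of `euclidActTest g⁻¹`). [folklore] -/
noncomputable def euclidActField (g : E ≃ᵃⁱ[ℝ] E) : FieldConfig E →L[ℝ] FieldConfig E :=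
  FieldConfig.act (euclidActTest g.symm)

/-- `(euclidActField g ω) f = ω (euclidActTest g⁻¹ f)`. [folklore] -/
@[simp]
theorem euclidActField_apply (g : E ≃ᵃⁱ[ℝ] E) (ω : FieldConfig E) (f : 𝓢(E, ℝ)) :
    euclidActField g ω f = ω (euclidActTest g.symm f) := rfl

/-- The Euclidean action sends the Dirac configuration `δₓ` to `δ_{g x}`. [folklore] -/
theorem euclidActField_deltaConfig (g : E ≃ᵃⁱ[ℝ] E) (x : E) :
    euclidActField g (deltaConfig x) = deltaConfig (g x) := by
  ext f
  simp

variable (d : ℕ) [NeZero d]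

/-- Time reflection of field configurations on `ℝ^d`: `(Θ ω) f = ω (Θ f)` (Glimm–Jaffe §6.1,
OS3; OS 1973 §2). [cite: OS1973, §2] -/
noncomputable def thetaField :
    FieldConfig (EuclideanSpace ℝ (Fin d)) →L[ℝ] FieldConfig (EuclideanSpace ℝ (Fin d)) :=
  FieldConfig.act (thetaTest d)

/-- `(thetaField d ω) f = ω (thetaTest d f)`. [folklore] -/
@[simp]
theorem thetaField_apply (ω : FieldConfig (EuclideanSpace ℝ (Fin d)))
    (f : 𝓢(EuclideanSpace ℝ (Fin d), ℝ)) : thetaField d ω f = ω (thetaTest d f) := rfl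

/-- Time translation of field configurations by `t`: translation by `t e₀`,
`δₓ ↦ δ_{x + t e₀}` (Glimm–Jaffe §6.1). [folklore] -/
noncomputable def timeShiftField (t : ℝ) :
    FieldConfig (EuclideanSpace ℝ (Fin d)) →L[ℝ] FieldConfig (EuclideanSpace ℝ (Fin d)) :=
  translateField (EuclideanSpace.single 0 t)

/-- `(timeShiftField d t ω) f = ω (timeShiftTest d (-t) f)`. [folklore] -/
theorem timeShiftField_apply (t : ℝ) (ω : FieldConfig (EuclideanSpace ℝ (Fin d)))
    (f : 𝓢(EuclideanSpace ℝ (Fin d), ℝ)) :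
    timeShiftField d t ω f = ω (timeShiftTest d (-t) f) := by
  simp [timeShiftField, timeShiftTest, PiLp.single_neg]

/-- Time translations of configurations form a one-parameter group:
`T_{s+t} = T_s ∘ T_t` (Glimm–Jaffe §6.1). [folklore] -/
theorem timeShiftField_add (s t : ℝ) :
    timeShiftField d (s + t) = (timeShiftField d s).comp (timeShiftField d t) := by
  ext ω f
  simp only [timeShiftField, translateField_apply, ContinuousLinearMap.coe_comp,
    Function.comp_apply]
  congr 1
  ext x
  simp only [translateTest_apply]
  congr 1
  rw [show EuclideanSpace.single (0 : Fin d) (s + t)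
      = EuclideanSpace.single 0 s + EuclideanSpace.single 0 t from PiLp.single_add 2 0]
  abel

end Config

/-! ### Invariance of laws -/

section Law

variable {E : Type*} [NormedAddCommGroup E] [NormedSpace ℝ E]

/-- A law `μ` on field configurations is *Euclidean invariant*: `g_* μ = μ` for every Euclidean
motion `g` (affine isometric automorphism of `E`). Osterwalder–Schrader axiom E1 / Glimm–Jaffe
§6.1, OS2. (Suffix `Law`: outline §0, to avoid `Literature.Probability.LatticeModels.IsEuclideanInvariant`.) [folklore] -/
def IsEuclideanInvariantLaw (μ : Measure (FieldConfig E)) : Prop :=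
  ∀ g : E ≃ᵃⁱ[ℝ] E, μ.map (euclidActField g) = μ

/-- A law `μ` on field configurations is *translation invariant*: `(τ_a)_* μ = μ` for all `a`.
Glimm–Jaffe §6.1. [folklore] -/
def IsTranslationInvariantLaw (μ : Measure (FieldConfig E)) : Prop :=
  ∀ a : E, μ.map (translateField a) = μ

/-- A law `μ` on field configurations is *rotation invariant*: invariant under every linear
isometry of `E` (the full orthogonal group, including reflections). Glimm–Jaffe §6.1. [folklore] -/
def IsRotationInvariantLaw (μ : Measure (FieldConfig E)) : Prop :=
  ∀ L : E ≃ₗᵢ[ℝ] E, μ.map (rotateField L) = μ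

/-- A law `μ` on field configurations over `ℝ^d` is *time-reflection invariant*: `Θ_* μ = μ`.
Glimm–Jaffe §6.1 (part of OS3). [folklore] -/
def IsTimeReflectionInvariantLaw (d : ℕ) [NeZero d]
    (μ : Measure (FieldConfig (EuclideanSpace ℝ (Fin d)))) : Prop :=
  μ.map (thetaField d) = μ

/-- Euclidean invariance implies translation invariance (translations are Euclidean motions;
Glimm–Jaffe §6.1). [cite: GlimmJaffe1987, §6.1] -/
def IsEuclideanInvariantLaw.isTranslationInvariantLaw : Prop :=
  ∀ {μ : Measure (FieldConfig E)} (hμ : IsEuclideanInvariantLaw μ),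
    IsTranslationInvariantLaw μ

/-- Euclidean invariance implies rotation invariance (linear isometries are Euclidean motions;
Glimm–Jaffe §6.1). [cite: GlimmJaffe1987, §6.1] -/
def IsEuclideanInvariantLaw.isRotationInvariantLaw : Prop :=
  ∀ {μ : Measure (FieldConfig E)} (hμ : IsEuclideanInvariantLaw μ),
    IsRotationInvariantLaw μ

end Law

/-! ### Positive-time test functions -/

section PositiveTime

variable {𝕜 : Type*} [RCLike 𝕜]
variable {d : ℕ} [NeZero d] {n : ℕ}

/-- A test function on `ℝ^d` is *positive-time* if its (topological) support lies in the open
half-space `{x⁰ > 0}`: `f ∈ 𝒮(ℝ^d_+)` in the closure sense of OS 1973 §2 (`𝒮₊`);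
Glimm–Jaffe §6.1 (OS3). [cite: OS1973, §2] -/
def IsPositiveTime (f : 𝓢(EuclideanSpace ℝ (Fin d), 𝕜)) : Prop :=
  tsupport (f : EuclideanSpace ℝ (Fin d) → 𝕜) ⊆ {x | 0 < x 0}

/-- A test function on `ℝ^d` is *nonnegative-time* if its support lies in the closed half-space
`{x⁰ ≥ 0}` (Glimm–Jaffe §6.1). [folklore] -/
def IsNonnegTime (f : 𝓢(EuclideanSpace ℝ (Fin d), 𝕜)) : Prop :=
  tsupport (f : EuclideanSpace ℝ (Fin d) → 𝕜) ⊆ {x | 0 ≤ x 0}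

/-- An `n`-point test function on `(ℝ^d)^n` is *positive-time* if its support lies in
`{x | ∀ i, (xᵢ)⁰ > 0}` (OS 1973 §2, `𝒮₊(ℝ^{dn})`). [cite: OS1973, §2] -/
def IsPositiveTimeMulti (F : 𝓢((Fin n → EuclideanSpace ℝ (Fin d)), ℂ)) : Prop :=
  tsupport (F : (Fin n → EuclideanSpace ℝ (Fin d)) → ℂ) ⊆ {x | ∀ i, 0 < x i 0}

/-- An `n`-point test function on `(ℝ^d)^n` is *time-ordered* if its support lies in
`{x | 0 < (x₁)⁰ < (x₂)⁰ < ⋯ < (xₙ)⁰}` (OS 1973 §2, `𝒮_<(ℝ^{dn})`). [cite: OS1973, §2] -/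
def IsTimeOrdered (F : 𝓢((Fin n → EuclideanSpace ℝ (Fin d)), ℂ)) : Prop :=
  tsupport (F : (Fin n → EuclideanSpace ℝ (Fin d)) → ℂ) ⊆
    {x | (∀ i, 0 < x i 0) ∧ StrictMono fun i => x i 0}

/-- A time-ordered test function is positive-time. [folklore] -/
theorem IsTimeOrdered.isPositiveTimeMulti {F : 𝓢((Fin n → EuclideanSpace ℝ (Fin d)), ℂ)}
    (hF : IsTimeOrdered F) : IsPositiveTimeMulti F :=
  fun _ hx => (hF hx).1

/-- A positive-time test function is nonnegative-time. [folklore] -/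
theorem IsPositiveTime.isNonnegTime {f : 𝓢(EuclideanSpace ℝ (Fin d), 𝕜)}
    (hf : IsPositiveTime f) : IsNonnegTime f :=
  fun _ hx => Set.mem_setOf.2 (le_of_lt (hf hx))

variable (𝕜 d) in
/-- The subspace `𝒮₊ ⊆ 𝒮(ℝ^d)` of positive-time test functions (OS 1973 §2). [cite: OS1973, §2] -/
def positiveTimeSubmodule : Submodule 𝕜 𝓢(EuclideanSpace ℝ (Fin d), 𝕜) where
  carrier := {f | IsPositiveTime f}
  add_mem' {f g} hf hg :=
    (tsupport_add (f : EuclideanSpace ℝ (Fin d) → 𝕜) g).trans (Set.union_subset hf hg)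
  zero_mem' := by
    change tsupport (fun _ : EuclideanSpace ℝ (Fin d) => (0 : 𝕜)) ⊆ _
    simp
  smul_mem' c f hf :=
    (tsupport_smul_subset_right (fun _ : EuclideanSpace ℝ (Fin d) => c)
      (f : EuclideanSpace ℝ (Fin d) → 𝕜)).trans hf

/-- Membership in `positiveTimeSubmodule` is `IsPositiveTime`. [folklore] -/
@[simp]
theorem mem_positiveTimeSubmodule {f : 𝓢(EuclideanSpace ℝ (Fin d), 𝕜)} :
    f ∈ positiveTimeSubmodule 𝕜 d ↔ IsPositiveTime f := Iff.rfl

/-- Time reflection maps positive-time test functions to negative-time ones: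
`supp (Θ f) ⊆ {x⁰ < 0}` (OS 1973 §2, `ϑ 𝒮₊ = 𝒮₋`). [cite: OS1973, §2] -/
def IsPositiveTime.thetaTest : Prop :=
  ∀ {f : 𝓢(EuclideanSpace ℝ (Fin d), 𝕜)} (hf : IsPositiveTime f),
    tsupport (QuantumLattice.thetaTest d f : EuclideanSpace ℝ (Fin d) → 𝕜) ⊆ {x | x 0 < 0}

/-- Time translation by `t ≥ 0` preserves positive-time test functions (OS 1973 §2). [cite: OS1973, §2] -/
def IsPositiveTime.timeShiftTest : Prop :=
  ∀ {f : 𝓢(EuclideanSpace ℝ (Fin d), 𝕜)} (hf : IsPositiveTime f) {t : ℝ} (ht : 0 ≤ t),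
    IsPositiveTime (QuantumLattice.timeShiftTest d t f)

end PositiveTime

/-! ### Discharges (D-0014: the named facts above that follow from Mathlib) -/

section Discharge

variable {𝕜 : Type*} [RCLike 𝕜]
variable {E : Type*} [NormedAddCommGroup E] [NormedSpace ℝ E]
variable {d : ℕ} [NeZero d]

/-- Translation of configurations is the action of the Euclidean motion `x ↦ a + x`
(`AffineIsometryEquiv.constVAdd`): `translateField a = euclidActField (a +ᵥ ·)`. [folklore] -/
theorem translateField_eq_euclidActField (a : E) :
    translateField a = euclidActField (AffineIsometryEquiv.constVAdd ℝ E a) := by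
  have h : (translateTest (-a) : 𝓢(E, ℝ) →L[ℝ] 𝓢(E, ℝ)) =
      euclidActTest (AffineIsometryEquiv.constVAdd ℝ E a).symm := by
    ext f x
    rw [translateTest_apply, euclidActTest_apply, AffineIsometryEquiv.symm_symm,
      AffineIsometryEquiv.coe_constVAdd]
    simp only [vadd_eq_add, sub_neg_eq_add, add_comm x a]
  rw [translateField, euclidActField, h]

/-- The action of a linear isometry on configurations is the action of the corresponding
Euclidean motion (`LinearIsometryEquiv.toAffineIsometryEquiv`). [folklore] -/
theorem rotateField_eq_euclidActField (L : E ≃ₗᵢ[ℝ] E) :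
    rotateField L = euclidActField L.toAffineIsometryEquiv := by
  have h : (linActTest L.symm : 𝓢(E, ℝ) →L[ℝ] 𝓢(E, ℝ)) =
      euclidActTest (L.toAffineIsometryEquiv).symm := by
    ext f x
    rw [linActTest_apply, euclidActTest_apply, AffineIsometryEquiv.symm_symm,
      LinearIsometryEquiv.coe_toAffineIsometryEquiv, LinearIsometryEquiv.symm_symm]
  rw [rotateField, euclidActField, h]

/-- **Discharge of `IsEuclideanInvariantLaw.isTranslationInvariantLaw`** (Glimm–Jaffe §6.1:
translations are Euclidean motions). [cite: GlimmJaffeQP1987, §6.1 (OS2)] -/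
theorem IsEuclideanInvariantLaw.isTranslationInvariantLaw_holds :
    IsEuclideanInvariantLaw.isTranslationInvariantLaw (E := E) := by
  intro μ hμ a
  rw [translateField_eq_euclidActField]
  exact hμ _

/-- **Discharge of `IsEuclideanInvariantLaw.isRotationInvariantLaw`** (Glimm–Jaffe §6.1: linear
isometries are Euclidean motions). [cite: GlimmJaffeQP1987, §6.1 (OS2)] -/
theorem IsEuclideanInvariantLaw.isRotationInvariantLaw_holds :
    IsEuclideanInvariantLaw.isRotationInvariantLaw (E := E) := by
  intro μ hμ L
  rw [rotateField_eq_euclidActField]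
  exact hμ _

/-- A Euclidean-invariant law on `𝒮'(ℝ^d)` is time-reflection invariant (`θ ∈ O(d)`;
Glimm–Jaffe §6.1, OS2 includes reflections). [cite: GlimmJaffeQP1987, §6.1 (OS2)] -/
theorem IsEuclideanInvariantLaw.isTimeReflectionInvariantLaw
    {μ : Measure (FieldConfig (EuclideanSpace ℝ (Fin d)))} (hμ : IsEuclideanInvariantLaw μ) :
    IsTimeReflectionInvariantLaw d μ := by
  have h : thetaField d = rotateField (timeReflection d) := by
    rw [thetaField, rotateField, timeReflection_symm, thetaTest]
  rw [IsTimeReflectionInvariantLaw, h, rotateField_eq_euclidActField]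
  exact hμ _

omit [NeZero d] in
/-- Support of a test function composed with a continuous map of the base:
`tsupport (f ∘ φ) ⊆ φ ⁻¹' tsupport f` (Mathlib `tsupport_comp_subset_preimage`), in the form
used for the OS positive-time spaces. [folklore] -/
theorem tsupport_schwartz_comp_subset {X : Type*} [TopologicalSpace X]
    (f : 𝓢(EuclideanSpace ℝ (Fin d), 𝕜)) {φ : X → EuclideanSpace ℝ (Fin d)} (hφ : Continuous φ) :
    tsupport (fun x => f (φ x)) ⊆ φ ⁻¹' tsupport (f : EuclideanSpace ℝ (Fin d) → 𝕜) :=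
  tsupport_comp_subset_preimage (f : EuclideanSpace ℝ (Fin d) → 𝕜) hφ

/-- **Discharge of `IsPositiveTime.thetaTest`** (OS 1973 §2, `ϑ𝒮₊ = 𝒮₋`): the support of
`Θf = f ∘ θ` is `θ⁻¹(supp f)`, and `(θx)⁰ = -x⁰`. [cite: OsterwalderSchraderCMP1973, §2] -/
theorem IsPositiveTime.thetaTest_holds : IsPositiveTime.thetaTest (𝕜 := 𝕜) (d := d) := by
  intro f hf x hx
  have hx' : x ∈ tsupport (fun y => f (timeReflection d y)) := by
    have : (QuantumLattice.thetaTest d f : EuclideanSpace ℝ (Fin d) → 𝕜) =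
        fun y => f (timeReflection d y) := funext fun y => thetaTest_apply d f y
    rwa [this] at hx
  have h := hf (tsupport_schwartz_comp_subset f (timeReflection d).continuous hx')
  simp only [Set.mem_setOf_eq, timeReflection_apply] at h
  simpa using h

/-- **Discharge of `IsPositiveTime.timeShiftTest`** (OS 1973 §2): the support of
`T_t f = f (· - t e₀)` is `supp f + t e₀`, whose time coordinates exceed `t ≥ 0`. [cite: OsterwalderSchraderCMP1973, §2] -/
theorem IsPositiveTime.timeShiftTest_holds : IsPositiveTime.timeShiftTest (𝕜 := 𝕜) (d := d) := by
  intro f hf t ht x hx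
  have hx' : x ∈ tsupport (fun y => f (y - EuclideanSpace.single 0 t)) := by
    have : (QuantumLattice.timeShiftTest d t f : EuclideanSpace ℝ (Fin d) → 𝕜) =
        fun y => f (y - EuclideanSpace.single 0 t) := funext fun y => timeShiftTest_apply d t f y
    rwa [this] at hx
  have h := hf (tsupport_schwartz_comp_subset f
    (continuous_id.sub continuous_const : Continuous fun y : EuclideanSpace ℝ (Fin d) =>
      y - EuclideanSpace.single 0 t) hx')
  have h' : 0 < x 0 - t := by
    have := h
    simp only [Set.mem_setOf_eq] at this
    simpa [PiLp.single_apply] using this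
  simp only [Set.mem_setOf_eq]
  linarith

end Discharge

end Literature.MathematicalPhysics.QuantumLattice
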